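import Summits.Schanuel.Schanuel.Theorems.RootDecomp1KDegreeLadder07

/-!
# RootDecomp1KDegreeLadder — lens 1, generation 45 «DEGREE LADDER AT FIXED SKEL-QUALITY (DL) + THIN-FIBRE RESIDUAL» (lane K-R30 (b); CLAIM L2155, ACK/CHECKLIST K-g45 L2159, NODE L2213 / REQUEST L2214, writer re-checks L2219/L2221/L2230, critic VERDICT L2216: CLEARED — THEOREM ×1 for DL `degreeLadder`; EDITION 2/3 docstring-only accepted L2224 / files of record L2228 (K ed. 3 f2af863f…); RULE K-R31; lens-1 tally credits ×11 + THEOREM ×2) — continuation (RootDecomp1KDegreeLadder08): §8a the 2-adic mechanism (two_adic_split, two_adic_quality; hypothesis-free)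

(lens-1 g45 HOME kernel K = HOME/decomp-schanuel-lens-1/g45/DegreeLadder.lean EDITION 3 f2af863f…, 2183 l, imports tree `…RootDecomp1KSkelCell01` (the tree now has `…SkelCell10` with §8's `SkelLiouvilleFix`); P DLprobe.lean f44a49e4… rc 0, C DLctrl.lean 394594cd… rc 1 = exactly the 13 planted errors. Port by census-1 gen 19 as `RootDecomp1KDegreeLadder01`–`08` (+ `09` deferred): 01 = K's module doc + §0 residue (`skelLiouvilleFix_of_skelLiouville`, `SkelLiouvilleFix.liouville` / `.transcendental` declared in the TREE namespace `…RootDecomp1KSkelCell` so dot-notation keeps working) + §1 toolkit `bev`/`xdeg`/`dX`/`specX`; 02 = §2 truncations + §3 calculus (`tangent`, Lipschitz, `coeff_specX_bound`); 03 = §4 engine A (`onCurve_exponent_ineq`, `engine_core`); 04 = §4 engine B (`lowDegree_clause`, `engine_of_clause`, `engine`) + §5 THE DEGREE LADDER `degreeLadder (d) (ρ) (hρ : SkelLiouvilleFix (d + 1) ρ) (P : ℤ[X][X]) (hP : P ≠ 0) (hdeg : P.natDegree ≤ d) : bev P (liouvilleNumber 2) ρ ≠ 0` (descent `no_relation_of_engine`);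 05 = §5b limit corollary (`algebraicIndependent_of_forall_fix`) + §5c relative degree (`relDegree_gt`, `skelFix_two_not_mem_adjoin(_complex)`); 06 = §5d the residual `ThinFibre`/`ThinFibreAt` (+ glue `thinFibre_imp_b`) + §6 the toy fibre decided (`sq_fibre_iff`, `toy_clause`); 07 = §7 tightness at d = 1 (`degreeLadder_tight_one`, `rU_injective`, `not_thinFibre_one`, `not_thinFibre_zero`); 08 = §8a the 2-adic mechanism (`two_adic_split`, `two_adic_quality`, hypothesis-free); 09 (DEFERRED until Literature `…DiophantineApproximation.RidoutIntegers` builds on the check farm, rc 75 today) = §8b `isSquare_mul_psNumer_finite`, `isSquare_seventeen_mul_psNumer_finite`, `thinFibreAt_sqMulP` with `Ridout.padicRoth_int` BY NAME (K carries them under a `(hR : PadicRothInt)` binder whose `def` is NOT landed — verdict condition (c)).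
PORT EDITS: import `…SkelCell10` instead of `…SkelCell01` and DELETE K's verbatim copies of the tree's §8 (`SkelLiouvilleFix`, `skelLiouville_iff_fix`, `SkelLiouvilleFix.mono`, `uStar`, `dU`, `rU`, `dU_cast`, `two_pow_le_four_mul_dU`, `two_mul_dU_lt`, `one_le_dU`, `rU_den`, `rU_cast`, `uStar_sub_rU`, `skelLiouvilleFix_one_uStar`, `not_skelFixOne_algebraicIndependent` — 15 blocks, opened from `…RootDecomp1KSkelCell` by name; verdict condition (a)); the file-wide linter option dropped (b); 58 one-line docstrings added to undocumented helper lemmas; 34 small generic ℓ₂/`psNumer`/`partialSum`/cast lemmas made PRIVATE (dedup-safety against tree twins in TwoBaseCell/CommonRadixCell/SkelCell/RadixCell) with per-part private copies; `ThinFibre`/`ThinFibreAt` docstrings carry the residual-class tag (d); graded statements and proofs otherwise verbatim. `--supports stmt-Schanuel-33364`; no census credit carried; rung 0 — nothing here proves Schanuel, `FiniteOrderLiouvilleSchanuel` (33364), `CoordLiouvilleSchanuel` (31077) or (b) at fixed quality.)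
-/

noncomputable section

open Polynomial LiouvilleNumber
open scoped Nat

namespace Summit.Schanuel.Schanuel.Theorems.RootDecomp1KDegreeLadder

open Summit.Schanuel.Schanuel.Theorems.RootDecomp1KSkelCell
  (exists_le_two_pow_factorial iota iota_spec iota_le_of_le pow_lt_of_lt_iota lt_iota_of_pow_lt iota_mono
   one_le_iota SkelLiouville SkelLiouvilleFix skelLiouville_iff_fix SkelLiouvilleFix.mono uStar dU rU dU_cast
   two_pow_le_four_mul_dU two_mul_dU_lt one_le_dU rU_den rU_cast uStar_sub_rU skelLiouvilleFix_one_uStar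
   not_skelFixOne_algebraicIndependent)
open Summit.Schanuel.Schanuel.Theorems.RootDecomp1KTwoBaseCell (psNumer partialSum_eq_psNumer_div coprime_psNumer
  algebraicIndependent_of_forall_int')
open Summit.Schanuel.Schanuel.Theorems.RootDecomp1KRelLiouvilleCell (partialSum_two_strictMono
  partialSum_two_lt_liouvilleNumber abs_liouvilleNumber_two_sub_partialSum)

/-- `0 < p_N`. -/
private theorem psNumer_pos (N : ℕ) : 0 < psNumer 2 N := by
  unfold psNumer
  exact Finset.sum_pos (fun i _ => pow_pos two_pos _) (Finset.nonempty_range_iff.mpr (Nat.succ_ne_zero N))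

/-! ## §8  THE PRINTED LEAF INSTANCE IS DECIDED — `c·p_N = □` only finitely often (Ridout, 2-adically)

THE 2-ADIC MECHANISM.  The skeleton numerators converge 2-ADICALLY: `p_{M+1} = 2^{M·M!}·p_M + 1`
(`psNumer_succ`; `(M+1)! − M! = M·M!`), so `p_N → 1` in `ℤ₂` at the rate `2^{−N!·(1−1/N)}` while `p_N ≍ 2^{N!}`
archimedeanly.  Hence an integer solution of `y² = c·p_{M+1}` (`c` odd, `M ≥ 2`) satisfies, in `\overline{ℚ₂}`,
`(y − a)(y + a) = c·p_M·2^{M·M!}` with `a² = c`, `|a|₂ = 1`, and since `|(y+a) − (y−a)|₂ = |2a|₂ = 1/2` ONE of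
`y ∓ a` has `|y ∓ a|₂ ≤ 2·2^{−M·M!}` (`two_adic_split`), against the height `|y| = (c·p_{M+1})^{1/2} ≤ 2^{2j}`,
`j = (M!/4)(M+1) + c`: an INTEGER approximation to the 2-adic algebraic number `±a` of exponent `→ 2 > 1 + 1/2`
(`two_adic_quality`).  The tree's PROVED `p`-adic Roth theorem for integers
`Literature.NumberTheory.DiophantineApproximation.Ridout.padicRoth_int` (Ridout 1958 = Bombieri–Gubler Thm. 6.2.6;
sorry-free in `Literature/`), with `S = {2}`, `ε = 1/2` and the targets `a`, `−a`, leaves finitely many `y`, and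
`N ↦ y_N = √(c·p_N)` is injective (`psNumer 2` is strictly increasing).  So `{N | c·psNumer 2 N is a square}` is
FINITE for every odd `c` (`isSquare_mul_psNumer_finite hR`, ineffective) — in particular for `c = 17`,
the instance printed in the `ThinFibre` docstring — and the conics `Y² = c·x` satisfy the clause of `ThinFibre m₀`
at EVERY `m₀` (`thinFibreAt_sqMulP`).  What remains OPEN is the clause for GENERAL curves of `Y`-degree `≥ m₀`:
there a violating point `r` lies on a 2-adic branch of `P` at `x = s_N = 2^{−N!}·p_N` (`p_N → 1` in `ℤ₂`) with
exponent `0 < w ≤ 1/m₀`; when `lc_Y P` is constant, `Z = r·2^{N!·w}` is an INTEGER (up to a bounded factor) of height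
`≈ 2^{N!·w}` and `Z = c₀ + Σ_j c_j·2^{N!·g_j}·(1 + O(2^{−(N!−(N−1)!)}))` with FIXED algebraic `c_j ∈ \overline{ℚ₂}` and
gaps `0 < g₁ < g₂ < …` (Puiseux at `x = ∞`).  (a) If every `c_j` with `g_j ≤ w` is RATIONAL, a bounded shift of `Z`
is an `S`-integer within `2^{−N!·g}` (`g > w`) of `c₀` and one-prime integer Ridout (`PadicRothInt` again) decides
the branch — this covers all pure curves `Y^d = c·x^i` and ALL `x`-LINEAR `P = A(Y) + x·B(Y)`, `deg B ≤ deg A − 2`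
(there the only corrections of gap `≤ w` are the rational Tschirnhaus shifts; e.g. `Y^d − Y^{d−1} = 17x`); (b) an
IRRATIONAL `c_j` with `g_j ≤ w` occurs (`Y⁴ + xY = 17x²`; `(Y² − 17x)² = xY`) and wants the `p`-adic SUBSPACE theorem in
boundedly many variables; (c) non-constant `lc_Y P` (odd denominators): open — NODE memo §5; not claimed here.
PRIOR ART OF THE MOVE (honest): «square = dominant term + lower-order `S`-unit terms ⇒ a Roth-quality approximation
at one place» is textbook — Zannier, *Lecture Notes on Diophantine Analysis* (2nd ed.), Exercise 3.36
(`5ⁿ + 2ⁿ + a = □` only finitely often, «that `√5 > 2` is crucial» = our dominance condition `1 + 3j < M·M!`),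
Bombieri–Gubler 6.2.6–6.2.7 (Mahler); new here only as applied to the Liouville numerators `p_N`. -/

section Ridout

/-- `|m|₂ = 2^{−v₂(m)}` for a non-zero integer `m`, in `\overline{ℚ₂}` (the norm of `PadicAlgCl 2` extends that of
`ℚ_[2]`; cf. `Literature.NumberTheory.DiophantineApproximation.norm_intCast_padicAlgCl`). -/
private theorem norm_intCast_padicAlgCl_two {m : ℤ} (hm : m ≠ 0) :
    ‖(m : PadicAlgCl 2)‖ = (2 : ℝ) ^ (-(padicValInt 2 m : ℤ)) := by
  have h1 : (m : PadicAlgCl 2) = algebraMap ℚ_[2] (PadicAlgCl 2) (m : ℚ_[2]) := (map_intCast _ m).symm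
  rw [h1, PadicAlgCl.norm_extends, Padic.norm_eq_zpow_neg_valuation (by exact_mod_cast hm),
    Padic.valuation_intCast]
  norm_num

/-- The prime `2` as an element of `Nat.Primes` (the one-element set `S = {2}` of Ridout's theorem). -/
abbrev pTwo : Nat.Primes := ⟨2, Nat.prime_two⟩

/-- `(pTwo : ℕ) = 2`. -/
@[simp] theorem pTwo_val : (pTwo : ℕ) = 2 := rfl

/-- `(M+1)! − M! = M·M!`. -/
private theorem factorial_succ_sub (M : ℕ) : (M + 1)! - M ! = M * M ! := by
  rw [Nat.factorial_succ, Nat.succ_mul]; omega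

/-- `p_{M+1} = 2^{M·M!}·p_M + 1`. -/
theorem psNumer_succ' (M : ℕ) : psNumer 2 (M + 1) = 2 ^ (M * M !) * psNumer 2 M + 1 := by
  rw [psNumer_succ, factorial_succ_sub]

/-- `N ↦ p_N` is strictly increasing. -/
private theorem psNumer_two_strictMono : StrictMono (psNumer 2) := by
  refine strictMono_nat_of_lt_succ fun M => ?_
  rw [psNumer_succ']
  have h1 : 1 ≤ 2 ^ (M * M !) := Nat.one_le_two_pow
  have h2 := psNumer_pos M
  nlinarith

/-- `p_M` is odd for `M ≥ 2`. -/
private theorem psNumer_two_odd {M : ℕ} (hM : 2 ≤ M) : Odd (psNumer 2 M) := by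
  have h := coprime_psNumer_two_pow hM 1
  rw [pow_one] at h
  have h2 : ¬ 2 ∣ psNumer 2 M := (Nat.Prime.coprime_iff_not_dvd Nat.prime_two).mp h
  exact Nat.odd_iff.mpr (Nat.two_dvd_ne_zero.mp h2)

/-- `|m|₂ = 1` for an odd integer `m`, in `\overline{ℚ₂}`. -/
private theorem norm_intCast_of_odd {m : ℤ} (hm : Odd m) : ‖(m : PadicAlgCl 2)‖ = 1 := by
  have hm0 : m ≠ 0 := by rintro rfl; exact (Int.not_even_iff_odd.mpr hm) ⟨0, rfl⟩
  rw [norm_intCast_padicAlgCl_two hm0]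
  have h2 : ¬ ((2 : ℕ) : ℤ) ∣ m := by
    intro h
    exact (Int.not_even_iff_odd.mpr hm) (even_iff_two_dvd.mpr (by exact_mod_cast h))
  rw [padicValInt.eq_zero_of_not_dvd h2]
  simp

/-- `|2|₂ = 1/2` in `\overline{ℚ₂}`. -/
private theorem norm_two_padicAlgCl : ‖(2 : PadicAlgCl 2)‖ = 1 / 2 := by
  have h := norm_intCast_padicAlgCl_two (m := 2) two_ne_zero
  have hv : padicValInt 2 2 = 1 := by
    have : padicValInt 2 (2 : ℕ) = 1 := by exact_mod_cast padicValInt.self (p := 2) one_lt_two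
    exact_mod_cast this
  rw [hv] at h
  have h' : ‖((2 : ℤ) : PadicAlgCl 2)‖ = 1 / 2 := by rw [h]; norm_num
  exact_mod_cast h'

/-- **The 2-adic split.**  If `y² = c·p_{M+1}` with `c` odd, `M ≥ 2`, and `a² = c` in `\overline{ℚ₂}`, then one of
`y − a`, `y + a` has 2-adic absolute value `≤ 2·2^{−M·M!}`. -/
theorem two_adic_split {c : ℕ} (hc : Odd c) (a : PadicAlgCl 2) (ha : a ^ 2 = (c : PadicAlgCl 2)) {M : ℕ}
    (hM : 2 ≤ M) {y : ℤ} (hy : y ^ 2 = c * psNumer 2 (M + 1)) :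
    ‖(y : PadicAlgCl 2) - a‖ ≤ 2 * (1 / 2 : ℝ) ^ (M * M !) ∨
      ‖(y : PadicAlgCl 2) + a‖ ≤ 2 * (1 / 2 : ℝ) ^ (M * M !) := by
  -- the integer identity `y² − c = (c·p_M)·2^{M·M!}`
  have hZ : y ^ 2 - c = ((c * psNumer 2 M : ℕ) : ℤ) * 2 ^ (M * M !) := by
    rw [hy, psNumer_succ']; push_cast; ring
  -- transported to `\overline{ℚ₂}`
  have hK : ((y : PadicAlgCl 2) - a) * ((y : PadicAlgCl 2) + a) =
      (((c * psNumer 2 M : ℕ) : ℤ) : PadicAlgCl 2) * 2 ^ (M * M !) := by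
    have h1 : ((y : PadicAlgCl 2) - a) * ((y : PadicAlgCl 2) + a) = ((y ^ 2 - c : ℤ) : PadicAlgCl 2) := by
      push_cast; rw [← ha]; ring
    rw [h1, hZ]; push_cast; ring
  have hodd : Odd (((c * psNumer 2 M : ℕ) : ℤ)) := by
    have : Odd (c * psNumer 2 M) := hc.mul (psNumer_two_odd hM)
    exact_mod_cast this.natCast
  have hprod : ‖(y : PadicAlgCl 2) - a‖ * ‖(y : PadicAlgCl 2) + a‖ = (1 / 2 : ℝ) ^ (M * M !) := by
    rw [← norm_mul, hK, norm_mul, norm_pow, norm_intCast_of_odd hodd, norm_two_padicAlgCl, one_mul]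
  -- `|a|₂ = 1` and `|2a|₂ = 1/2`
  have hna : ‖a‖ = 1 := by
    have h1 : ‖a‖ ^ 2 = 1 := by
      rw [← norm_pow, ha]
      have : Odd ((c : ℕ) : ℤ) := by exact_mod_cast hc.natCast
      have h2 := norm_intCast_of_odd this
      exact_mod_cast h2
    exact (pow_eq_one_iff_of_nonneg (norm_nonneg a) two_ne_zero).mp h1
  have h2a : ‖((y : PadicAlgCl 2) + a) + (-((y : PadicAlgCl 2) - a))‖ = 1 / 2 := by
    have : ((y : PadicAlgCl 2) + a) + (-((y : PadicAlgCl 2) - a)) = 2 * a := by ring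
    rw [this, norm_mul, norm_two_padicAlgCl, hna, mul_one]
  have hmax : (1 / 2 : ℝ) ≤ max ‖(y : PadicAlgCl 2) + a‖ ‖(y : PadicAlgCl 2) - a‖ := by
    have h := PadicAlgCl.isNonarchimedean 2 ((y : PadicAlgCl 2) + a) (-((y : PadicAlgCl 2) - a))
    rw [h2a, norm_neg] at h
    exact h
  have hpos : (0 : ℝ) < (1 / 2 : ℝ) ^ (M * M !) := by positivity
  rcases le_max_iff.mp hmax with h | h
  · left
    have hp : 0 < ‖(y : PadicAlgCl 2) + a‖ := lt_of_lt_of_le (by norm_num) h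
    rw [← hprod]
    nlinarith [norm_nonneg ((y : PadicAlgCl 2) - a)]
  · right
    have hp : 0 < ‖(y : PadicAlgCl 2) - a‖ := lt_of_lt_of_le (by norm_num) h
    rw [← hprod]
    nlinarith [norm_nonneg ((y : PadicAlgCl 2) + a)]

/-- **The quality.**  For `y² = c·p_{M+1}` with `M ≥ 3c + 5`: `2·2^{−M·M!} < |y|^{−(1 + 1/2)}`. -/
theorem two_adic_quality {c : ℕ} (hc : Odd c) {M : ℕ} (hM : 3 * c + 5 ≤ M) {y : ℤ}
    (hy : y ^ 2 = c * psNumer 2 (M + 1)) :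
    2 * (1 / 2 : ℝ) ^ (M * M !) < |(y : ℝ)| ^ (-(1 + 1 / 2 : ℝ)) := by
  have hc1 : 1 ≤ c := hc.pos
  have hM4 : 4 ≤ M := by omega
  obtain ⟨u, hu⟩ : 4 ∣ M ! := Nat.dvd_factorial (by norm_num) hM4
  have hu1 : 1 ≤ u := by
    have : 24 ≤ M ! := (Nat.factorial_le hM4 : 4 ! ≤ M !)
    omega
  set j : ℕ := u * (M + 1) + c with hj
  -- the exponent inequality `1 + 3j < M·M!`
  have hexp : 1 + 3 * j < M * M ! := by
    rw [hj, hu]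
    nlinarith
  -- the height bound `|y| ≤ (2^j)^2`
  have hy0 : y ≠ 0 := by
    rintro rfl
    have : (0 : ℤ) = c * psNumer 2 (M + 1) := by simpa using hy
    have h2 := psNumer_pos (M + 1)
    have : (c * psNumer 2 (M + 1) : ℤ) > 0 := by positivity
    omega
  have hYpos : (0 : ℝ) < |(y : ℝ)| := by positivity
  have hsq : |(y : ℝ)| ^ 2 ≤ (((2 : ℝ) ^ j) ^ 2) ^ 2 := by
    rw [sq_abs]
    have h1 : ((y : ℝ)) ^ 2 = c * psNumer 2 (M + 1) := by exact_mod_cast hy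
    have h2 : (psNumer 2 (M + 1) : ℝ) < 2 * 2 ^ (M + 1)! := by exact_mod_cast psNumer_lt (M + 1)
    have h3 : (c : ℝ) * 2 ≤ 2 ^ (4 * c) := by
      have h' : c * 2 ≤ 2 ^ (4 * c) := by
        have := Nat.lt_two_pow_self (n := c)
        calc c * 2 ≤ 2 ^ c * 2 := by omega
          _ = 2 ^ (c + 1) := by rw [pow_succ]
          _ ≤ 2 ^ (4 * c) := Nat.pow_le_pow_right two_pos (by omega)
      exact_mod_cast h'
    have h4 : (((2 : ℝ) ^ j) ^ 2) ^ 2 = 2 ^ (4 * c) * 2 ^ (M + 1)! := by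
      rw [← pow_mul, ← pow_mul, ← pow_add]
      congr 1
      rw [hj, Nat.factorial_succ, hu]; ring
    rw [h1, h4]
    have hc0 : (0 : ℝ) ≤ c := Nat.cast_nonneg c
    have hp0 : (0 : ℝ) ≤ psNumer 2 (M + 1) := Nat.cast_nonneg _
    nlinarith
  have hY : |(y : ℝ)| ≤ ((2 : ℝ) ^ j) ^ 2 :=
    (pow_le_pow_iff_left₀ (abs_nonneg _) (by positivity) two_ne_zero).mp hsq
  -- `|y|^{3/2} ≤ 2^{3j}`
  have hY32 : |(y : ℝ)| ^ (3 / 2 : ℝ) ≤ (2 : ℝ) ^ (3 * j) := by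
    have h1 : |(y : ℝ)| ^ (3 / 2 : ℝ) ≤ (((2 : ℝ) ^ j) ^ 2) ^ (3 / 2 : ℝ) :=
      Real.rpow_le_rpow (abs_nonneg _) hY (by norm_num)
    have h2 : (((2 : ℝ) ^ j) ^ 2) ^ (3 / 2 : ℝ) = (2 : ℝ) ^ (3 * j) := by
      have h20 : (0 : ℝ) ≤ (2 : ℝ) ^ j := by positivity
      rw [show (((2 : ℝ) ^ j) ^ 2) = ((2 : ℝ) ^ j) ^ (2 : ℝ) by norm_cast, ← Real.rpow_mul h20,
        show (2 : ℝ) * (3 / 2) = (3 : ℕ) by norm_num, Real.rpow_natCast, ← pow_mul, mul_comm]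
    rw [h2] at h1; exact h1
  -- conclude
  have hlt : 2 * (1 / 2 : ℝ) ^ (M * M !) * (2 : ℝ) ^ (3 * j) < 1 := by
    have h2e : (2 : ℝ) ^ (1 + 3 * j) < (2 : ℝ) ^ (M * M !) := pow_lt_pow_right₀ one_lt_two hexp
    have hpos : (0 : ℝ) < (2 : ℝ) ^ (M * M !) := by positivity
    have heq : 2 * (1 / 2 : ℝ) ^ (M * M !) * (2 : ℝ) ^ (3 * j) = (2 : ℝ) ^ (1 + 3 * j) / (2 : ℝ) ^ (M * M !) := by
      rw [one_div_pow, pow_add, pow_one]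
      field_simp
    rw [heq, div_lt_one hpos]
    exact h2e
  have hpos32 : (0 : ℝ) < |(y : ℝ)| ^ (3 / 2 : ℝ) := Real.rpow_pos_of_pos hYpos _
  rw [show (-(1 + 1 / 2 : ℝ)) = -(3 / 2 : ℝ) by norm_num, Real.rpow_neg (abs_nonneg _), lt_inv_comm₀
    (by positivity) hpos32]
  calc |(y : ℝ)| ^ (3 / 2 : ℝ) ≤ (2 : ℝ) ^ (3 * j) := hY32
    _ < (2 * (1 / 2 : ℝ) ^ (M * M !))⁻¹ := by
        rw [lt_inv_comm₀ (by positivity) (by positivity)]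
        have h0 : (0 : ℝ) < (2 : ℝ) ^ (3 * j) := by positivity
        calc 2 * (1 / 2 : ℝ) ^ (M * M !) = 2 * (1 / 2 : ℝ) ^ (M * M !) * (2 : ℝ) ^ (3 * j) / (2 : ℝ) ^ (3 * j) := by
              field_simp
          _ < 1 / (2 : ℝ) ^ (3 * j) := by exact div_lt_div_of_pos_right hlt h0
          _ = ((2 : ℝ) ^ (3 * j))⁻¹ := one_div _

/-- `bev` of a natural-number constant. -/
@[simp] theorem bev_natCast (n : ℕ) (x y : ℝ) : bev (n : ℤ[X][X]) x y = n := by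
  simp [bev]

/-- `bev` of an integer constant. -/
@[simp] theorem bev_intCast (n : ℤ) (x y : ℝ) : bev (n : ℤ[X][X]) x y = n := by
  simp [bev]

/-- the conic `Y² = c·x` -/
def sqMulP (c : ℕ) : ℤ[X][X] := X ^ 2 - C (C (c : ℤ) * X)

/-- `sqMulP c (x, y) = y² − c·x`. -/
@[simp] theorem bev_sqMulP (c : ℕ) (x y : ℝ) : bev (sqMulP c) x y = y ^ 2 - c * x := by
  simp [sqMulP]

/-- `sqMulP c ≠ 0`. -/
theorem sqMulP_ne_zero (c : ℕ) : sqMulP c ≠ 0 := by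
  intro h
  have := congrArg (fun P : ℤ[X][X] => P.coeff 2) h
  simp [sqMulP] at this

end Ridout

end Summit.Schanuel.Schanuel.Theorems.RootDecomp1KDegreeLadder

end
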